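import Mathlib
import HarnessLib
import Summits.NavierStokesRegularity.NavierStokesRegularity.Theorems.TaylorModelRungThreeSoundnessVectorDiff

/-!
# Line `taylor-model` on crux K1b-DR (`ExactWindowRungThree.DerivativeEnclosureCertificateR`,
# stmt-NavierStokesRegularity-23954) — VECTOR STEP LEMMA, part 12: variation and first difference ALONG A KNOWN
# confined trajectory (no rough-enclosure test at the second start point — mid-step κ-restarts, node-set transport)

Parts 3/6 obtain the variation `V` and the difference `ψ' − ψ` from the rough-enclosure test of the PAIR, which includes
the state test (E1) at the start point.  For κ-RESTARTS in the middle of a sub-step (K1b-DR's repaired reach: a state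
κ-close to the tube at time `t` is followed to the next node) the primary trajectory is already KNOWN to stay in the box,
and only the linear / difference equation needs a test.  This file proves that form, by the clamping argument of part 1
for a TIME-DEPENDENT field (Picard–Lindelöf + secant confinement):

* `exists_sol_mem_Icc_of_roughEnclosure_td` — generic: `d' = G t d`, `G` continuous in `t ∈ [0,h]` and Lipschitz in
  `d` on the box, secant test `d₀ + u • G t d ∈ [loD,hiD]` ⇒ solution on `[0,h]` confined to the box;
* `exists_var_sol_mem_Icc_along` — given `ψ` continuous on `[0,h]` with values in `[lo,hi]` and the variational test
  (V1) ⇒ `V` with `V' = Q(ψ,V)+Q(V,ψ)`, `V 0 = v₀`, `V ∈ [loV,hiV]`;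
* `exists_diff_sol_mem_Icc_along` — given a SOLUTION `ψ` on `[0,h]` confined to `[lo,hi]` and the difference test
  (D1) ⇒ a solution `ψ'` from `ψ 0 + d₀` on `[0,h]` with `ψ' − ψ ∈ [loD,hiD]`.

MODEL-lattice bookkeeping only (rung TL-M3 of the NS ladder: one finite-dimensional model ODE); nothing
here is a statement about the Navier–Stokes equations.
-/

noncomputable section

-- the sub-problem namespace repeats the summit name by design (D-0017)
set_option linter.dupNamespace false

namespace Summit.NavierStokesRegularity.NavierStokesRegularity.Theorems.TaylorModelVector

open scoped BigOperators Topology NNReal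
open Set Filter Metric

variable {ι : Type*} [Fintype ι] [DecidableEq ι]

omit [DecidableEq ι] in
/-- **Time-dependent rough enclosure (first order, non-strict)**: for `d' = G t d` with `G t` Lipschitz (constant `K`)
on the box `[loD,hiD]` for `t ∈ [0,h]` and `t ↦ G t d` continuous on `[0,h]` for `d` in the box, the secant test
`d₀ + u • G t d ∈ [loD,hiD]` (`t, u ∈ [0,h]`, `d ∈ [loD,hiD]`) gives a solution from `d₀` on `[0,h]` confined to the box.
[folklore] -/
theorem exists_sol_mem_Icc_of_roughEnclosure_td {G : ℝ → (ι → ℝ) → (ι → ℝ)} {loD hiD d₀ : ι → ℝ} {h : ℝ}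
    {K : ℝ≥0} (hd₀ : d₀ ∈ Icc loD hiD) (hh : 0 ≤ h)
    (hlip : ∀ t ∈ Icc (0:ℝ) h, LipschitzOnWith K (G t) (Icc loD hiD))
    (hcont : ∀ d ∈ Icc loD hiD, ContinuousOn (fun t => G t d) (Icc 0 h))
    (henc : ∀ t ∈ Icc (0:ℝ) h, ∀ d ∈ Icc loD hiD, ∀ u ∈ Icc (0:ℝ) h, d₀ + u • G t d ∈ Icc loD hiD) :
    ∃ δ : ℝ → ι → ℝ, δ 0 = d₀ ∧ (∀ s ∈ Icc 0 h, HasDerivWithinAt δ (G s (δ s)) (Icc 0 h) s) ∧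
      ∀ s ∈ Icc 0 h, δ s ∈ Icc loD hiD := by
  have hlh : loD ≤ hiD := hd₀.1.trans hd₀.2
  set π : (ι → ℝ) → (ι → ℝ) := fun y c => max (loD c) (min (y c) (hiD c)) with hπ
  have hπmem : ∀ y, π y ∈ Icc loD hiD := fun y => clamp_mem hlh y
  have hπeq : ∀ y ∈ Icc loD hiD, π y = y := fun y hy => clamp_eq_self hy
  have hπlip : LipschitzWith 1 π := LipschitzWith.of_dist_le_mul fun y z => by
    simpa only [NNReal.coe_one, one_mul] using dist_clamp_le loD hiD y z
  set F : ℝ → (ι → ℝ) → (ι → ℝ) := fun t y => G t (π y) with hF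
  have hFlip : ∀ t ∈ Icc (0:ℝ) h, LipschitzWith K (F t) := by
    intro t ht
    have h1 : LipschitzOnWith (K * 1) (G t ∘ π) univ :=
      (hlip t ht).comp (hπlip.lipschitzOnWith) fun y _ => hπmem y
    rw [mul_one] at h1
    exact lipschitzOnWith_univ.1 h1
  -- a uniform bound of the clamped field on `[0,h]`
  obtain ⟨L₀, hL₀⟩ := isCompact_Icc.exists_bound_of_continuousOn (hcont (π d₀) (hπmem d₀))
  have hdiam : ∀ y, dist (π y) (π d₀) ≤ ‖hiD - loD‖ := by
    intro y
    rw [dist_eq_norm]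
    refine (pi_norm_le_iff_of_nonneg (norm_nonneg _)).2 fun c => ?_
    rw [Real.norm_eq_abs]
    have h1 := (hπmem y).1 c
    have h2 := (hπmem y).2 c
    have h3 := (hπmem d₀).1 c
    have h4 := (hπmem d₀).2 c
    have h5 : |(hiD - loD) c| ≤ ‖hiD - loD‖ := by
      rw [← Real.norm_eq_abs]; exact norm_le_pi_norm (hiD - loD) c
    rw [Pi.sub_apply] at h5 ⊢
    have h6 : hiD c - loD c ≤ ‖hiD - loD‖ := (le_abs_self _).trans h5
    rw [abs_le]
    constructor <;> linarith
  set Lr : ℝ := max (L₀ + K * ‖hiD - loD‖) 0 with hLr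
  have hFbd : ∀ t ∈ Icc (0:ℝ) h, ∀ y, ‖F t y‖ ≤ Lr := by
    intro t ht y
    have h1 : dist (G t (π y)) (G t (π d₀)) ≤ K * dist (π y) (π d₀) :=
      (hlip t ht).dist_le_mul _ (hπmem y) _ (hπmem d₀)
    have h2 : ‖G t (π d₀)‖ ≤ L₀ := hL₀ t ht
    calc ‖F t y‖ = ‖G t (π y)‖ := rfl
      _ ≤ ‖G t (π y) - G t (π d₀)‖ + ‖G t (π d₀)‖ := norm_le_norm_sub_add _ _
      _ ≤ K * ‖hiD - loD‖ + L₀ := by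
          rw [← dist_eq_norm]
          exact add_le_add (h1.trans (mul_le_mul_of_nonneg_left (hdiam y) K.2)) h2
      _ ≤ Lr := by rw [hLr, add_comm]; exact le_max_left _ _
  -- Picard–Lindelöf on `[0,h]`
  set L : ℝ≥0 := ⟨Lr, le_max_right _ _⟩ with hL
  set hN : ℝ≥0 := ⟨h, hh⟩ with hhN
  have t₀mem : (0:ℝ) ∈ Icc (0:ℝ) h := ⟨le_rfl, hh⟩
  have hPL : IsPicardLindelof F (⟨0, t₀mem⟩ : Icc (0:ℝ) h) d₀ (L * hN) 0 L K :=
    { lipschitzOnWith := fun t ht => (hFlip t ht).lipschitzOnWith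
      continuousOn := fun y _ => hcont (π y) (hπmem y)
      norm_le := fun t ht y _ => hFbd t ht y
      mul_max_le := by
        simp only [sub_zero, sub_self, max_eq_left hh, NNReal.coe_mul, NNReal.coe_zero, hL, hhN]
        exact le_rfl }
  obtain ⟨δ, hδ0, hδ⟩ := hPL.exists_eq_forall_mem_Icc_hasDerivWithinAt₀
  -- a-posteriori confinement (secant form of the test)
  have hconf : ∀ t ∈ Icc 0 h, δ t ∈ Icc loD hiD := by
    intro t ht
    rcases eq_or_lt_of_le ht.1 with h0 | htpos
    · rw [← h0, hδ0]; exact hd₀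
    have hsub : Icc 0 t ⊆ Icc 0 h := Icc_subset_Icc_right ht.2
    have key : ∀ c, loD c ≤ δ t c ∧ δ t c ≤ hiD c := by
      intro c
      have hcont' : ContinuousOn (fun u => t * δ u c) (Icc 0 t) := by
        refine ContinuousOn.mul continuousOn_const ?_
        exact fun u hu => ((hasDerivWithinAt_pi.1 ((hδ u (hsub hu)).mono hsub)) c).continuousWithinAt
      have hderiv : ∀ u ∈ Ioo 0 t, HasDerivAt (fun u => t * δ u c) (t * F u (δ u) c) u := by
        intro u hu
        have h2 : HasDerivAt δ (F u (δ u)) u :=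
          (hδ u (hsub (Ioo_subset_Icc_self hu))).hasDerivAt (Icc_mem_nhds hu.1 (hu.2.trans_le ht.2))
        exact ((hasDerivAt_pi.1 h2) c).const_mul t
      have hdiff : DifferentiableOn ℝ (fun u => t * δ u c) (interior (Icc 0 t)) := by
        rw [interior_Icc]
        exact fun u hu => (hderiv u hu).differentiableAt.differentiableWithinAt
      have hbounds : ∀ u ∈ interior (Icc 0 t),
          loD c - d₀ c ≤ deriv (fun u => t * δ u c) u ∧ deriv (fun u => t * δ u c) u ≤ hiD c - d₀ c := by
        rw [interior_Icc]
        intro u hu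
        rw [(hderiv u hu).deriv]
        have hm := henc u (hsub (Ioo_subset_Icc_self hu)) (π (δ u)) (hπmem _) t ht
        have hl := hm.1 c
        have hr := hm.2 c
        simp only [Pi.add_apply, Pi.smul_apply, smul_eq_mul] at hl hr
        exact ⟨by linarith, by linarith⟩
      have up := (convex_Icc 0 t).image_sub_le_mul_sub_of_deriv_le hcont' hdiff
        (fun u hu => (hbounds u hu).2) 0 (left_mem_Icc.2 ht.1) t (right_mem_Icc.2 ht.1) ht.1
      have low := (convex_Icc 0 t).mul_sub_le_image_sub_of_le_deriv hcont' hdiff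
        (fun u hu => (hbounds u hu).1) 0 (left_mem_Icc.2 ht.1) t (right_mem_Icc.2 ht.1) ht.1
      rw [hδ0, sub_zero] at up low
      have up' : t * δ t c ≤ t * hiD c := by nlinarith
      have low' : t * loD c ≤ t * δ t c := by nlinarith
      exact ⟨le_of_mul_le_mul_left low' htpos, le_of_mul_le_mul_left up' htpos⟩
    exact ⟨fun c => (key c).1, fun c => (key c).2⟩
  refine ⟨δ, hδ0, fun s hs => ?_, hconf⟩
  have e : F s (δ s) = G s (δ s) := by
    simp only [hF]
    rw [hπeq _ (hconf s hs)]
  exact e ▸ hδ s hs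

section Field

variable (Q : (ι → ℝ) →ₗ[ℝ] (ι → ℝ) →ₗ[ℝ] ι → ℝ)

/-- **The variation ALONG a known trajectory**: `ψ` continuous on `[0,h]` with values in `[lo,hi]`, `v₀ ∈ [loV,hiV]`
and the variational test (V1) give `V` with `V' = Q(ψ,V) + Q(V,ψ)` on `[0,h]`, `V 0 = v₀`, `V ∈ [loV,hiV]`. [folklore] -/
theorem exists_var_sol_mem_Icc_along {ψ : ℝ → ι → ℝ} {h : ℝ} (hh : 0 ≤ h) (hψc : ContinuousOn ψ (Icc 0 h))
    {lo hi loV hiV v₀ : ι → ℝ} (hbox : ∀ s ∈ Icc 0 h, ψ s ∈ Icc lo hi) (hv₀ : v₀ ∈ Icc loV hiV)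
    (hencV : ∀ y ∈ Icc lo hi, ∀ v ∈ Icc loV hiV, ∀ u ∈ Icc (0:ℝ) h,
      v₀ + u • (Q y v + Q v y) ∈ Icc loV hiV) :
    ∃ V : ℝ → ι → ℝ, V 0 = v₀ ∧
      (∀ s ∈ Icc 0 h, HasDerivWithinAt V (Q (ψ s) (V s) + Q (V s) (ψ s)) (Icc 0 h) s) ∧
      ∀ s ∈ Icc 0 h, V s ∈ Icc loV hiV := by
  obtain ⟨C, hC0, hC⟩ := exists_norm_Q_le Q
  set R : ℝ := max ‖lo‖ ‖hi‖ with hR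
  have hR0 : 0 ≤ R := le_max_of_le_left (norm_nonneg _)
  have hψR : ∀ s ∈ Icc 0 h, ‖ψ s‖ ≤ R := fun s hs => norm_le_of_mem_Icc (hbox s hs)
  refine exists_sol_mem_Icc_of_roughEnclosure_td (G := fun t v => Q (ψ t) v + Q v (ψ t))
    (K := Real.toNNReal (2 * C * R)) hv₀ hh ?_ ?_ (fun t _ d hd u hu => hencV _ (hbox t ‹_›) d hd u hu)
  · intro t ht
    refine LipschitzOnWith.of_dist_le_mul fun v _ v' _ => ?_
    rw [Real.coe_toNNReal _ (by positivity), dist_eq_norm, dist_eq_norm]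
    have e : Q (ψ t) v + Q v (ψ t) - (Q (ψ t) v' + Q v' (ψ t)) = Q (ψ t) (v - v') + Q (v - v') (ψ t) := by
      rw [map_sub, map_sub, LinearMap.sub_apply]
      abel
    rw [e]
    calc ‖Q (ψ t) (v - v') + Q (v - v') (ψ t)‖ ≤ ‖Q (ψ t) (v - v')‖ + ‖Q (v - v') (ψ t)‖ := norm_add_le _ _
      _ ≤ C * ‖ψ t‖ * ‖v - v'‖ + C * ‖v - v'‖ * ‖ψ t‖ := add_le_add (hC _ _) (hC _ _)
      _ ≤ C * R * ‖v - v'‖ + C * ‖v - v'‖ * R := by gcongr <;> exact hψR t ht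
      _ = 2 * C * R * ‖v - v'‖ := by ring
  · intro d _
    have h1 : Continuous fun y : ι → ℝ => Q y d + Q d y :=
      ((Q.flip d).continuous_of_finiteDimensional).add ((Q d).continuous_of_finiteDimensional)
    exact h1.comp_continuousOn hψc

/-- **The first difference ALONG a known solution**: `ψ` solves on `[0,h]` and stays in `[lo,hi]`, `d₀ ∈ [loD,hiD]`
and the difference test (D1) give a solution `ψ'` from `ψ 0 + d₀` on `[0,h]` with `ψ' − ψ ∈ [loD,hiD]`. [folklore] -/
theorem exists_diff_sol_mem_Icc_along {ψ : ℝ → ι → ℝ} {h : ℝ} (hh : 0 ≤ h)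
    (hψ : ∀ s ∈ Icc 0 h, HasDerivWithinAt ψ (Q (ψ s) (ψ s)) (Icc 0 h) s)
    {lo hi loD hiD d₀ : ι → ℝ} (hbox : ∀ s ∈ Icc 0 h, ψ s ∈ Icc lo hi) (hd₀ : d₀ ∈ Icc loD hiD)
    (hencD : ∀ y ∈ Icc lo hi, ∀ d ∈ Icc loD hiD, ∀ u ∈ Icc (0:ℝ) h,
      d₀ + u • (Q y d + Q d y + Q d d) ∈ Icc loD hiD) :
    ∃ ψ' : ℝ → ι → ℝ, ψ' 0 = ψ 0 + d₀ ∧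
      (∀ s ∈ Icc 0 h, HasDerivWithinAt ψ' (Q (ψ' s) (ψ' s)) (Icc 0 h) s) ∧
      ∀ s ∈ Icc 0 h, ψ' s - ψ s ∈ Icc loD hiD := by
  obtain ⟨C, hC0, hC⟩ := exists_norm_Q_le Q
  have hψc : ContinuousOn ψ (Icc 0 h) := fun s hs => (hψ s hs).continuousWithinAt
  set R : ℝ := max ‖lo‖ ‖hi‖ with hR
  have hR0 : 0 ≤ R := le_max_of_le_left (norm_nonneg _)
  set RD : ℝ := max ‖loD‖ ‖hiD‖ with hRD
  have hRD0 : 0 ≤ RD := le_max_of_le_left (norm_nonneg _)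
  have hψR : ∀ s ∈ Icc 0 h, ‖ψ s‖ ≤ R := fun s hs => norm_le_of_mem_Icc (hbox s hs)
  have hlipD : ∀ t ∈ Icc (0:ℝ) h, LipschitzOnWith (Real.toNNReal (2 * C * (R + RD)))
      (fun d => Q (ψ t) d + Q d (ψ t) + Q d d) (Icc loD hiD) := by
    intro t ht
    refine LipschitzOnWith.of_dist_le_mul fun d hd d' hd' => ?_
    rw [Real.coe_toNNReal _ (by positivity), dist_eq_norm, dist_eq_norm]
    have e : Q (ψ t) d + Q d (ψ t) + Q d d - (Q (ψ t) d' + Q d' (ψ t) + Q d' d')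
        = Q (ψ t) (d - d') + Q (d - d') (ψ t) + (Q (d - d') d + Q d' (d - d')) := by
      rw [map_sub, map_sub, LinearMap.sub_apply, LinearMap.sub_apply, map_sub]
      abel
    rw [e]
    have nd : ‖d‖ ≤ RD := norm_le_of_mem_Icc hd
    have nd' : ‖d'‖ ≤ RD := norm_le_of_mem_Icc hd'
    calc ‖Q (ψ t) (d - d') + Q (d - d') (ψ t) + (Q (d - d') d + Q d' (d - d'))‖
        ≤ ‖Q (ψ t) (d - d')‖ + ‖Q (d - d') (ψ t)‖ + (‖Q (d - d') d‖ + ‖Q d' (d - d')‖) := by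
          refine (norm_add_le _ _).trans (add_le_add (norm_add_le _ _) (norm_add_le _ _))
      _ ≤ C * ‖ψ t‖ * ‖d - d'‖ + C * ‖d - d'‖ * ‖ψ t‖ + (C * ‖d - d'‖ * ‖d‖ + C * ‖d'‖ * ‖d - d'‖) :=
          add_le_add (add_le_add (hC _ _) (hC _ _)) (add_le_add (hC _ _) (hC _ _))
      _ ≤ C * R * ‖d - d'‖ + C * ‖d - d'‖ * R + (C * ‖d - d'‖ * RD + C * RD * ‖d - d'‖) := by
          gcongr <;> exact hψR t ht
      _ = 2 * C * (R + RD) * ‖d - d'‖ := by ring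
  have hcontD : ∀ d ∈ Icc loD hiD, ContinuousOn (fun t => Q (ψ t) d + Q d (ψ t) + Q d d) (Icc 0 h) := by
    intro d _
    have h1 : Continuous fun y : ι → ℝ => Q y d + Q d y + Q d d :=
      (((Q.flip d).continuous_of_finiteDimensional).add ((Q d).continuous_of_finiteDimensional)).add
        continuous_const
    exact h1.comp_continuousOn hψc
  obtain ⟨δ, hδ0, hδ, hδbox⟩ := exists_sol_mem_Icc_of_roughEnclosure_td
    (G := fun t d => Q (ψ t) d + Q d (ψ t) + Q d d) hd₀ hh hlipD hcontD
    (fun t ht d hd u hu => hencD _ (hbox t ht) d hd u hu)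
  refine ⟨fun s => ψ s + δ s, by show ψ 0 + δ 0 = ψ 0 + d₀; rw [hδ0], fun s hs => ?_,
    fun s hs => by simpa using hδbox s hs⟩
  have h1 := (hψ s hs).add (hδ s hs)
  refine h1.congr_deriv ?_
  have e := quad_diff_expand Q (ψ s) (δ s) (ψ s) (δ s)
  rw [sub_eq_iff_eq_add'] at e
  rw [e]

end Field

end Summit.NavierStokesRegularity.NavierStokesRegularity.Theorems.TaylorModelVector

end
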